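/-
Copyright (c) 2026 the pub-hodgecm-mathlib formalisation cell (harness21).  Prover seat hodgecm-mathlib-LH4-p09 (g8), req620 Track A «(D-RAM) FOUR-FRAME» squad
(heir dealer LH4-plan (g13) WORD #87 ∕ #89 ∕ #92 (d): (T-box | lev) (c) — the BLOCK EVALUATION between FILE 3∕3's `hArith` and F0P3a-p01 (g36)'s FILE 2 tiling).  2026-09-04.
-/
import Summits.HodgeConjecture.HodgeConjecture.Theorems.F0P3cDyRamKappaCountBoxSumTruncatedTiling   -- ★ p860013 (LH4-p10 (g6)): `window_mul_eval_trunc`; brings ★ `…KappaCountBoxSumTiling` (`leaf_T ∕ leaf_TT ∕ leaf_Z`), ★ `…Planes` (`foot_mul_eval`)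
import HarnessLib

/-!
# (D-RAM) four-frame, STAGE 1b — (T-box | lev) (c): THE BLOCK EVALUATION of the arithmetic `hArith` of ★ p860395 `…LevLabelledKappaBoxSum.levLabelledBoxSumWide_of_arith`:
# `(q−1)·(diagonal window + three plane blocks)` in closed form, leaving the pure EXPONENT TILING ‹CORE› (F0P3a-p01 (g36)'s FILE 2a ★ p860523 ∕ 2b letters)

Helper brick for dealer LH4-plan (g13) WORD #87 ∕ #89 (d) (second hand on F0P3a-p01 (g36)'s (c)): `Theorems/` only, statement-first, ★-only imports, lane
`--supports stmt-HodgeConjecture-24833 --as helper`; PAYS NO tier-0 row (count-neutral).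
* `levBoxArith_of_core (hcore : ‹CORE›) : ‹∀ (q d n₁ n₂ n₃ k ℓ₁ ℓ₂ : ℕ) (i : Fin 3) (ω εH : ℚ) (εG : Fin 3 → Fin 3 → ℚ),
        2 ≤ d → ((n₁ = n₂ ∧ n₁ ≤ n₃) ∨ (n₁ = n₃ ∧ n₁ ≤ n₂) ∨ (n₂ = n₃ ∧ n₂ ≤ n₁)) →
        (2 * d ≤ n₁ + 1 ∧ 2 * d ≤ n₂ + 1 ∧ 2 * d ≤ n₃ + 1) → ℓ₁ ≤ 2 → (ℓ₂ ≤ n₁ + ℓ₁ ∧ ℓ₂ ≤ n₂ + ℓ₁ ∧ ℓ₂ ≤ n₃ + ℓ₁) →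
        (d % 2 = 0 → ℓ₁ = 1 → d + 1 ≤ ℓ₂) → n₁ % 2 = d % 2 → n₂ % 2 = d % 2 → n₃ % 2 = d % 2 → 2 * k + d = n₁ + n₂ + n₃ + 2 →
        (i = 0 → n₂ = n₃ → n₂ + 2 * d ≤ n₁ → εG 0 0 = ω) → (i = 1 → n₁ = n₃ → n₁ + 2 * d ≤ n₂ → εG 1 1 = ω) →
        (i = 2 → n₁ = n₂ → n₁ + 2 * d ≤ n₃ → εG 2 2 = ω) →
        ((q : ℚ) - 1) *
            ((if n₁ = n₂ ∧ n₂ = n₃ then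
                    εH *
                      ∑
                        c ∈
                          Icc 1
                            (min (n₁ - ℓ₁ - (n₁ - ℓ₁) / 2)
                              (min ((2 * n₁ - ℓ₂) / 2 - (n₁ - ℓ₁) / 2) ((2 * n₁ - d + 1 - ℓ₁) / 2 - (n₁ - ℓ₁) / 2))),
                        if d ≤ c then (q : ℚ) ^ (2 * ((n₁ - ℓ₁) / 2) + c) else 0
                  else 0) +
                  ((if i = 0 then
                      ω *
                        (∑ j ∈ Icc d ((n₁ - ℓ₁) / 2), (q : ℚ) ^ j +
                          ∑ ρ ∈ Icc 1 (min (min n₂ n₃) (min (n₂ - ℓ₁) (2 * n₂ - ℓ₂)) / 2),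
                            ((if ρ + d ≤ (n₁ - ℓ₁) / 2 then (q : ℚ) ^ ((n₁ - ℓ₁) / 2 + ρ) - (q : ℚ) ^ (2 * ρ + d - 1) else 0) -
                              if ρ + d ≤ (n₁ - ℓ₁) / 2 + 1 then (q : ℚ) ^ (2 * ρ + d - 2) else 0))
                    else 0) +
                    if n₂ = n₃ ∧ n₂ < n₁ ∧ (n₁ - n₂) % 2 = 0 then
                      εG 0 i *
                        ∑
                          c ∈
                            Icc 1
                              (min (n₂ - ℓ₁ - (n₂ - ℓ₁) / 2)
                                (min ((2 * n₂ - ℓ₂) / 2 - (n₂ - ℓ₁) / 2) ((2 * n₂ - d + 1 - ℓ₁) / 2 - (n₂ - ℓ₁) / 2))),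
                          if (i = 0 → d ≤ (n₁ - n₂) / 2 + c) ∧ (i ≠ 0 → d ≤ c) then
                            (q : ℚ) ^ (2 * ((n₂ - ℓ₁) / 2) + (n₁ - n₂) / 2 + c)
                          else 0
                    else 0) +
                ((if i = 1 then
                    ω *
                      (∑ j ∈ Icc d ((n₂ - ℓ₁) / 2), (q : ℚ) ^ j +
                        ∑ ρ ∈ Icc 1 (min (min n₁ n₃) (min (n₁ - ℓ₁) (2 * n₁ - ℓ₂)) / 2),
                          ((if ρ + d ≤ (n₂ - ℓ₁) / 2 then (q : ℚ) ^ ((n₂ - ℓ₁) / 2 + ρ) - (q : ℚ) ^ (2 * ρ + d - 1) else 0) -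
                            if ρ + d ≤ (n₂ - ℓ₁) / 2 + 1 then (q : ℚ) ^ (2 * ρ + d - 2) else 0))
                  else 0) +
                  if n₁ = n₃ ∧ n₁ < n₂ ∧ (n₂ - n₁) % 2 = 0 then
                    εG 1 i *
                      ∑
                        c ∈
                          Icc 1
                            (min (n₁ - ℓ₁ - (n₁ - ℓ₁) / 2)
                              (min ((2 * n₁ - ℓ₂) / 2 - (n₁ - ℓ₁) / 2) ((2 * n₁ - d + 1 - ℓ₁) / 2 - (n₁ - ℓ₁) / 2))),
                        if (i = 1 → d ≤ (n₂ - n₁) / 2 + c) ∧ (i ≠ 1 → d ≤ c) then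
                          (q : ℚ) ^ (2 * ((n₁ - ℓ₁) / 2) + (n₂ - n₁) / 2 + c)
                        else 0
                  else 0) +
              ((if i = 2 then
                  ω *
                    (∑ j ∈ Icc d ((n₃ - ℓ₁) / 2), (q : ℚ) ^ j +
                      ∑ ρ ∈ Icc 1 (min (min n₁ n₂) (min (n₂ - ℓ₁) (2 * n₂ - ℓ₂)) / 2),
                        ((if ρ + d ≤ (n₃ - ℓ₁) / 2 then (q : ℚ) ^ ((n₃ - ℓ₁) / 2 + ρ) - (q : ℚ) ^ (2 * ρ + d - 1) else 0) -
                          if ρ + d ≤ (n₃ - ℓ₁) / 2 + 1 then (q : ℚ) ^ (2 * ρ + d - 2) else 0))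
                else 0) +
                if n₁ = n₂ ∧ n₁ < n₃ ∧ (n₃ - n₁) % 2 = 0 then
                  εG 2 i *
                    ∑
                      c ∈
                        Icc 1
                          (min (n₁ - ℓ₁ - (n₁ - ℓ₁) / 2)
                            (min ((2 * n₁ - ℓ₂) / 2 - (n₁ - ℓ₁) / 2) ((2 * n₁ - d + 1 - ℓ₁) / 2 - (n₁ - ℓ₁) / 2))),
                      if (i = 2 → d ≤ (n₃ - n₁) / 2 + c) ∧ (i ≠ 2 → d ≤ c) then (q : ℚ) ^ (2 * ((n₁ - ℓ₁) / 2) + (n₃ - n₁) / 2 + c)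
                      else 0
                else 0)) =
          (if n₁ = n₂ ∧ n₂ = n₃ then εH else if n₂ = n₃ then εG 0 i else if n₁ = n₃ then εG 1 i else εG 2 i) *
            ((q : ℚ) ^ (k - max ℓ₁ ((ℓ₂ + 1) / 2 - d / 2 + (ℓ₁ + 1 - d % 2) / 2)) -
              (q : ℚ) ^
                (k -
                  max (max ℓ₁ ((ℓ₂ + 1) / 2 - d / 2 + (ℓ₁ + 1 - d % 2) / 2))
                    (((![n₁, n₂, n₃] : Fin 3 → ℕ) i + 2 * (d % 2) + 2 - 3 * d) / 2 + 2 * ((ℓ₁ + 1 - d % 2) / 2))))›` — ★ `foot_mul_eval` (tube feet, `N := (n−ℓ₁)∕2`), ★ `window_mul_eval_trunc` (diagonal window `L := d`, cut windows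
  `L := if i = p then d − s∕2 else d`, tops = FILE 1's three-way minima) turn `hArith` into the tiling identity ‹CORE› on evaluated blocks.

HONEST LABEL: helper, conditional on the exponent tiling ‹CORE› (F0P3a-p01 (g36)'s FILE 2b `kappa_arith_lev` over ★ p860523's linearised letters, or LH4-p10 (g6)'s cut-window route); lev laws OPEN; HC_CM is proved only modulo the 7 printed citations (2 remaining named inputs: hLiu418 = `stmt-HodgeConjecture-24832`,
h413 = `stmt-HodgeConjecture-24833`) until rung 0 closes.

## References
* [Kottwitz1986BaseChangeUnits] R. E. Kottwitz, *Base change for unit elements of Hecke algebras*, Compositio Math. 60 (1986), §1 pp. 240–241.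
* [Rogawski1990] J. D. Rogawski, *Automorphic Representations of Unitary Groups in Three Variables*, Ann. of Math. Stud. 123 (1990), §4.9 Prop. 4.9.1 (a) p. 55; §4.10 p. 58.
-/

set_option autoImplicit false

namespace Summit.HodgeConjecture.HodgeConjecture.Cruxes.H413.F0P3cDyRamLevBoxSumBlocks

open Finset
open Summit.HodgeConjecture.HodgeConjecture.Cruxes.H413.F0P3cDyRamKappaCountBoxSumPlanes (foot_mul_eval)
open Summit.HodgeConjecture.HodgeConjecture.Cruxes.H413.F0P3cDyRamKappaCountBoxSumTiling (leaf_T leaf_TT leaf_Z)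
open Summit.HodgeConjecture.HodgeConjecture.Cruxes.H413.F0P3cDyRamKappaCountBoxSumTruncatedTiling (window_mul_eval_trunc)

/-- **BLOCK EVALUATION**: the arithmetic of FILE 3∕3 from the tiling identity on evaluated blocks. [cite: Kottwitz1986BaseChangeUnits, §1 pp. 240–241]
[cite: Rogawski1990, §4.9 Prop. 4.9.1 (a) p. 55; §4.10 p. 58] -/
theorem levBoxArith_of_core
    (hcore : ∀ (q d n₁ n₂ n₃ k ℓ₁ ℓ₂ : ℕ) (i : Fin 3) (ω εH : ℚ) (εG : Fin 3 → Fin 3 → ℚ),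
      2 ≤ d → ((n₁ = n₂ ∧ n₁ ≤ n₃) ∨ (n₁ = n₃ ∧ n₁ ≤ n₂) ∨ (n₂ = n₃ ∧ n₂ ≤ n₁)) →
      (2 * d ≤ n₁ + 1 ∧ 2 * d ≤ n₂ + 1 ∧ 2 * d ≤ n₃ + 1) → ℓ₁ ≤ 2 → (ℓ₂ ≤ n₁ + ℓ₁ ∧ ℓ₂ ≤ n₂ + ℓ₁ ∧ ℓ₂ ≤ n₃ + ℓ₁) →
      (d % 2 = 0 → ℓ₁ = 1 → d + 1 ≤ ℓ₂) → n₁ % 2 = d % 2 → n₂ % 2 = d % 2 → n₃ % 2 = d % 2 → 2 * k + d = n₁ + n₂ + n₃ + 2 →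
      (i = 0 → n₂ = n₃ → n₂ + 2 * d ≤ n₁ → εG 0 0 = ω) → (i = 1 → n₁ = n₃ → n₁ + 2 * d ≤ n₂ → εG 1 1 = ω) →
      (i = 2 → n₁ = n₂ → n₁ + 2 * d ≤ n₃ → εG 2 2 = ω) →
      (if n₁ = n₂ ∧ n₂ = n₃ then
                εH *
                  if
                      max 1 d ≤
                        min (n₁ - ℓ₁ - (n₁ - ℓ₁) / 2)
                          (min ((2 * n₁ - ℓ₂) / 2 - (n₁ - ℓ₁) / 2) ((2 * n₁ - d + 1 - ℓ₁) / 2 - (n₁ - ℓ₁) / 2)) then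
                    (q : ℚ) ^
                        (2 * ((n₁ - ℓ₁) / 2) +
                            min (n₁ - ℓ₁ - (n₁ - ℓ₁) / 2)
                              (min ((2 * n₁ - ℓ₂) / 2 - (n₁ - ℓ₁) / 2) ((2 * n₁ - d + 1 - ℓ₁) / 2 - (n₁ - ℓ₁) / 2)) +
                          1) -
                      (q : ℚ) ^ (2 * ((n₁ - ℓ₁) / 2) + max 1 d)
                  else 0
              else 0) +
              ((if i = 0 then
                  if min (min n₂ n₃) (min (n₂ - ℓ₁) (2 * n₂ - ℓ₂)) / 2 + d ≤ (n₁ - ℓ₁) / 2 then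
                    ω *
                      ((q : ℚ) ^ ((n₁ - ℓ₁) / 2 + min (min n₂ n₃) (min (n₂ - ℓ₁) (2 * n₂ - ℓ₂)) / 2 + 1) -
                        (q : ℚ) ^ (2 * (min (min n₂ n₃) (min (n₂ - ℓ₁) (2 * n₂ - ℓ₂)) / 2) + d))
                  else 0
                else 0) +
                if n₂ = n₃ ∧ n₂ < n₁ ∧ (n₁ - n₂) % 2 = 0 then
                  εG 0 i *
                    if
                        max 1 (if i = 0 then d - (n₁ - n₂) / 2 else d) ≤
                          min (n₂ - ℓ₁ - (n₂ - ℓ₁) / 2)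
                            (min ((2 * n₂ - ℓ₂) / 2 - (n₂ - ℓ₁) / 2) ((2 * n₂ - d + 1 - ℓ₁) / 2 - (n₂ - ℓ₁) / 2)) then
                      (q : ℚ) ^
                          (2 * ((n₂ - ℓ₁) / 2) + (n₁ - n₂) / 2 +
                              min (n₂ - ℓ₁ - (n₂ - ℓ₁) / 2)
                                (min ((2 * n₂ - ℓ₂) / 2 - (n₂ - ℓ₁) / 2) ((2 * n₂ - d + 1 - ℓ₁) / 2 - (n₂ - ℓ₁) / 2)) +
                            1) -
                        (q : ℚ) ^ (2 * ((n₂ - ℓ₁) / 2) + (n₁ - n₂) / 2 + max 1 (if i = 0 then d - (n₁ - n₂) / 2 else d))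
                    else 0
                else 0) +
            ((if i = 1 then
                if min (min n₁ n₃) (min (n₁ - ℓ₁) (2 * n₁ - ℓ₂)) / 2 + d ≤ (n₂ - ℓ₁) / 2 then
                  ω *
                    ((q : ℚ) ^ ((n₂ - ℓ₁) / 2 + min (min n₁ n₃) (min (n₁ - ℓ₁) (2 * n₁ - ℓ₂)) / 2 + 1) -
                      (q : ℚ) ^ (2 * (min (min n₁ n₃) (min (n₁ - ℓ₁) (2 * n₁ - ℓ₂)) / 2) + d))
                else 0
              else 0) +
              if n₁ = n₃ ∧ n₁ < n₂ ∧ (n₂ - n₁) % 2 = 0 then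
                εG 1 i *
                  if
                      max 1 (if i = 1 then d - (n₂ - n₁) / 2 else d) ≤
                        min (n₁ - ℓ₁ - (n₁ - ℓ₁) / 2)
                          (min ((2 * n₁ - ℓ₂) / 2 - (n₁ - ℓ₁) / 2) ((2 * n₁ - d + 1 - ℓ₁) / 2 - (n₁ - ℓ₁) / 2)) then
                    (q : ℚ) ^
                        (2 * ((n₁ - ℓ₁) / 2) + (n₂ - n₁) / 2 +
                            min (n₁ - ℓ₁ - (n₁ - ℓ₁) / 2)
                              (min ((2 * n₁ - ℓ₂) / 2 - (n₁ - ℓ₁) / 2) ((2 * n₁ - d + 1 - ℓ₁) / 2 - (n₁ - ℓ₁) / 2)) +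
                          1) -
                      (q : ℚ) ^ (2 * ((n₁ - ℓ₁) / 2) + (n₂ - n₁) / 2 + max 1 (if i = 1 then d - (n₂ - n₁) / 2 else d))
                  else 0
              else 0) +
          ((if i = 2 then
              if min (min n₁ n₂) (min (n₂ - ℓ₁) (2 * n₂ - ℓ₂)) / 2 + d ≤ (n₃ - ℓ₁) / 2 then
                ω *
                  ((q : ℚ) ^ ((n₃ - ℓ₁) / 2 + min (min n₁ n₂) (min (n₂ - ℓ₁) (2 * n₂ - ℓ₂)) / 2 + 1) -
                    (q : ℚ) ^ (2 * (min (min n₁ n₂) (min (n₂ - ℓ₁) (2 * n₂ - ℓ₂)) / 2) + d))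
              else 0
            else 0) +
            if n₁ = n₂ ∧ n₁ < n₃ ∧ (n₃ - n₁) % 2 = 0 then
              εG 2 i *
                if
                    max 1 (if i = 2 then d - (n₃ - n₁) / 2 else d) ≤
                      min (n₁ - ℓ₁ - (n₁ - ℓ₁) / 2)
                        (min ((2 * n₁ - ℓ₂) / 2 - (n₁ - ℓ₁) / 2) ((2 * n₁ - d + 1 - ℓ₁) / 2 - (n₁ - ℓ₁) / 2)) then
                  (q : ℚ) ^
                      (2 * ((n₁ - ℓ₁) / 2) + (n₃ - n₁) / 2 +
                          min (n₁ - ℓ₁ - (n₁ - ℓ₁) / 2)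
                            (min ((2 * n₁ - ℓ₂) / 2 - (n₁ - ℓ₁) / 2) ((2 * n₁ - d + 1 - ℓ₁) / 2 - (n₁ - ℓ₁) / 2)) +
                        1) -
                    (q : ℚ) ^ (2 * ((n₁ - ℓ₁) / 2) + (n₃ - n₁) / 2 + max 1 (if i = 2 then d - (n₃ - n₁) / 2 else d))
                else 0
            else 0) =
        (if n₁ = n₂ ∧ n₂ = n₃ then εH else if n₂ = n₃ then εG 0 i else if n₁ = n₃ then εG 1 i else εG 2 i) *
          ((q : ℚ) ^ (k - max ℓ₁ ((ℓ₂ + 1) / 2 - d / 2 + (ℓ₁ + 1 - d % 2) / 2)) -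
            (q : ℚ) ^
              (k -
                max (max ℓ₁ ((ℓ₂ + 1) / 2 - d / 2 + (ℓ₁ + 1 - d % 2) / 2))
                  (((![n₁, n₂, n₃] : Fin 3 → ℕ) i + 2 * (d % 2) + 2 - 3 * d) / 2 + 2 * ((ℓ₁ + 1 - d % 2) / 2))))) :
    ∀ (q d n₁ n₂ n₃ k ℓ₁ ℓ₂ : ℕ) (i : Fin 3) (ω εH : ℚ) (εG : Fin 3 → Fin 3 → ℚ),
        2 ≤ d → ((n₁ = n₂ ∧ n₁ ≤ n₃) ∨ (n₁ = n₃ ∧ n₁ ≤ n₂) ∨ (n₂ = n₃ ∧ n₂ ≤ n₁)) →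
        (2 * d ≤ n₁ + 1 ∧ 2 * d ≤ n₂ + 1 ∧ 2 * d ≤ n₃ + 1) → ℓ₁ ≤ 2 → (ℓ₂ ≤ n₁ + ℓ₁ ∧ ℓ₂ ≤ n₂ + ℓ₁ ∧ ℓ₂ ≤ n₃ + ℓ₁) →
        (d % 2 = 0 → ℓ₁ = 1 → d + 1 ≤ ℓ₂) → n₁ % 2 = d % 2 → n₂ % 2 = d % 2 → n₃ % 2 = d % 2 → 2 * k + d = n₁ + n₂ + n₃ + 2 →
        (i = 0 → n₂ = n₃ → n₂ + 2 * d ≤ n₁ → εG 0 0 = ω) → (i = 1 → n₁ = n₃ → n₁ + 2 * d ≤ n₂ → εG 1 1 = ω) →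
        (i = 2 → n₁ = n₂ → n₁ + 2 * d ≤ n₃ → εG 2 2 = ω) →
        ((q : ℚ) - 1) *
            ((if n₁ = n₂ ∧ n₂ = n₃ then
                    εH *
                      ∑
                        c ∈
                          Icc 1
                            (min (n₁ - ℓ₁ - (n₁ - ℓ₁) / 2)
                              (min ((2 * n₁ - ℓ₂) / 2 - (n₁ - ℓ₁) / 2) ((2 * n₁ - d + 1 - ℓ₁) / 2 - (n₁ - ℓ₁) / 2))),
                        if d ≤ c then (q : ℚ) ^ (2 * ((n₁ - ℓ₁) / 2) + c) else 0
                  else 0) +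
                  ((if i = 0 then
                      ω *
                        (∑ j ∈ Icc d ((n₁ - ℓ₁) / 2), (q : ℚ) ^ j +
                          ∑ ρ ∈ Icc 1 (min (min n₂ n₃) (min (n₂ - ℓ₁) (2 * n₂ - ℓ₂)) / 2),
                            ((if ρ + d ≤ (n₁ - ℓ₁) / 2 then (q : ℚ) ^ ((n₁ - ℓ₁) / 2 + ρ) - (q : ℚ) ^ (2 * ρ + d - 1) else 0) -
                              if ρ + d ≤ (n₁ - ℓ₁) / 2 + 1 then (q : ℚ) ^ (2 * ρ + d - 2) else 0))
                    else 0) +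
                    if n₂ = n₃ ∧ n₂ < n₁ ∧ (n₁ - n₂) % 2 = 0 then
                      εG 0 i *
                        ∑
                          c ∈
                            Icc 1
                              (min (n₂ - ℓ₁ - (n₂ - ℓ₁) / 2)
                                (min ((2 * n₂ - ℓ₂) / 2 - (n₂ - ℓ₁) / 2) ((2 * n₂ - d + 1 - ℓ₁) / 2 - (n₂ - ℓ₁) / 2))),
                          if (i = 0 → d ≤ (n₁ - n₂) / 2 + c) ∧ (i ≠ 0 → d ≤ c) then
                            (q : ℚ) ^ (2 * ((n₂ - ℓ₁) / 2) + (n₁ - n₂) / 2 + c)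
                          else 0
                    else 0) +
                ((if i = 1 then
                    ω *
                      (∑ j ∈ Icc d ((n₂ - ℓ₁) / 2), (q : ℚ) ^ j +
                        ∑ ρ ∈ Icc 1 (min (min n₁ n₃) (min (n₁ - ℓ₁) (2 * n₁ - ℓ₂)) / 2),
                          ((if ρ + d ≤ (n₂ - ℓ₁) / 2 then (q : ℚ) ^ ((n₂ - ℓ₁) / 2 + ρ) - (q : ℚ) ^ (2 * ρ + d - 1) else 0) -
                            if ρ + d ≤ (n₂ - ℓ₁) / 2 + 1 then (q : ℚ) ^ (2 * ρ + d - 2) else 0))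
                  else 0) +
                  if n₁ = n₃ ∧ n₁ < n₂ ∧ (n₂ - n₁) % 2 = 0 then
                    εG 1 i *
                      ∑
                        c ∈
                          Icc 1
                            (min (n₁ - ℓ₁ - (n₁ - ℓ₁) / 2)
                              (min ((2 * n₁ - ℓ₂) / 2 - (n₁ - ℓ₁) / 2) ((2 * n₁ - d + 1 - ℓ₁) / 2 - (n₁ - ℓ₁) / 2))),
                        if (i = 1 → d ≤ (n₂ - n₁) / 2 + c) ∧ (i ≠ 1 → d ≤ c) then
                          (q : ℚ) ^ (2 * ((n₁ - ℓ₁) / 2) + (n₂ - n₁) / 2 + c)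
                        else 0
                  else 0) +
              ((if i = 2 then
                  ω *
                    (∑ j ∈ Icc d ((n₃ - ℓ₁) / 2), (q : ℚ) ^ j +
                      ∑ ρ ∈ Icc 1 (min (min n₁ n₂) (min (n₂ - ℓ₁) (2 * n₂ - ℓ₂)) / 2),
                        ((if ρ + d ≤ (n₃ - ℓ₁) / 2 then (q : ℚ) ^ ((n₃ - ℓ₁) / 2 + ρ) - (q : ℚ) ^ (2 * ρ + d - 1) else 0) -
                          if ρ + d ≤ (n₃ - ℓ₁) / 2 + 1 then (q : ℚ) ^ (2 * ρ + d - 2) else 0))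
                else 0) +
                if n₁ = n₂ ∧ n₁ < n₃ ∧ (n₃ - n₁) % 2 = 0 then
                  εG 2 i *
                    ∑
                      c ∈
                        Icc 1
                          (min (n₁ - ℓ₁ - (n₁ - ℓ₁) / 2)
                            (min ((2 * n₁ - ℓ₂) / 2 - (n₁ - ℓ₁) / 2) ((2 * n₁ - d + 1 - ℓ₁) / 2 - (n₁ - ℓ₁) / 2))),
                      if (i = 2 → d ≤ (n₃ - n₁) / 2 + c) ∧ (i ≠ 2 → d ≤ c) then (q : ℚ) ^ (2 * ((n₁ - ℓ₁) / 2) + (n₃ - n₁) / 2 + c)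
                      else 0
                else 0)) =
          (if n₁ = n₂ ∧ n₂ = n₃ then εH else if n₂ = n₃ then εG 0 i else if n₁ = n₃ then εG 1 i else εG 2 i) *
            ((q : ℚ) ^ (k - max ℓ₁ ((ℓ₂ + 1) / 2 - d / 2 + (ℓ₁ + 1 - d % 2) / 2)) -
              (q : ℚ) ^
                (k -
                  max (max ℓ₁ ((ℓ₂ + 1) / 2 - d / 2 + (ℓ₁ + 1 - d % 2) / 2))
                    (((![n₁, n₂, n₃] : Fin 3 → ℕ) i + 2 * (d % 2) + 2 - 3 * d) / 2 + 2 * ((ℓ₁ + 1 - d % 2) / 2)))) := by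
  intro q d n₁ n₂ n₃ k ℓ₁ ℓ₂ i ω εH εG hd hiso hfence hℓ₁ hℓ₂ hcorner h1 h2 h3 hk hω0 hω1 hω2
  obtain ⟨hf1, hf2, hf3⟩ := hfence
  have hd1 : 1 ≤ d := by omega
  -- tube feet (★ `foot_mul_eval`), in the distributed form the goal shows
  have eF0 : ((q : ℚ) - 1) * (ω * ∑ j ∈ Icc d ((n₁ - ℓ₁) / 2), (q : ℚ) ^ j) + ((q : ℚ) - 1) * (ω * ∑ ρ ∈ Icc 1 (min (min n₂ n₃) (min (n₂ - ℓ₁) (2 * n₂ - ℓ₂)) / 2),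
      ((if ρ + d ≤ (n₁ - ℓ₁) / 2 then (q : ℚ) ^ ((n₁ - ℓ₁) / 2 + ρ) - (q : ℚ) ^ (2 * ρ + d - 1) else 0) - (if ρ + d ≤ (n₁ - ℓ₁) / 2 + 1 then (q : ℚ) ^ (2 * ρ + d - 2) else 0)))
      = if min (min n₂ n₃) (min (n₂ - ℓ₁) (2 * n₂ - ℓ₂)) / 2 + d ≤ (n₁ - ℓ₁) / 2 then ω * ((q : ℚ) ^ ((n₁ - ℓ₁) / 2 + min (min n₂ n₃) (min (n₂ - ℓ₁) (2 * n₂ - ℓ₂)) / 2 + 1) - (q : ℚ) ^ (2 * (min (min n₂ n₃) (min (n₂ - ℓ₁) (2 * n₂ - ℓ₂)) / 2) + d)) else 0 := by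
    rw [← mul_add, ← mul_add]; exact foot_mul_eval (q : ℚ) ω hd1 _ _
  have eF1 : ((q : ℚ) - 1) * (ω * ∑ j ∈ Icc d ((n₂ - ℓ₁) / 2), (q : ℚ) ^ j) + ((q : ℚ) - 1) * (ω * ∑ ρ ∈ Icc 1 (min (min n₁ n₃) (min (n₁ - ℓ₁) (2 * n₁ - ℓ₂)) / 2),
      ((if ρ + d ≤ (n₂ - ℓ₁) / 2 then (q : ℚ) ^ ((n₂ - ℓ₁) / 2 + ρ) - (q : ℚ) ^ (2 * ρ + d - 1) else 0) - (if ρ + d ≤ (n₂ - ℓ₁) / 2 + 1 then (q : ℚ) ^ (2 * ρ + d - 2) else 0)))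
      = if min (min n₁ n₃) (min (n₁ - ℓ₁) (2 * n₁ - ℓ₂)) / 2 + d ≤ (n₂ - ℓ₁) / 2 then ω * ((q : ℚ) ^ ((n₂ - ℓ₁) / 2 + min (min n₁ n₃) (min (n₁ - ℓ₁) (2 * n₁ - ℓ₂)) / 2 + 1) - (q : ℚ) ^ (2 * (min (min n₁ n₃) (min (n₁ - ℓ₁) (2 * n₁ - ℓ₂)) / 2) + d)) else 0 := by
    rw [← mul_add, ← mul_add]; exact foot_mul_eval (q : ℚ) ω hd1 _ _
  have eF2 : ((q : ℚ) - 1) * (ω * ∑ j ∈ Icc d ((n₃ - ℓ₁) / 2), (q : ℚ) ^ j) + ((q : ℚ) - 1) * (ω * ∑ ρ ∈ Icc 1 (min (min n₁ n₂) (min (n₂ - ℓ₁) (2 * n₂ - ℓ₂)) / 2),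
      ((if ρ + d ≤ (n₃ - ℓ₁) / 2 then (q : ℚ) ^ ((n₃ - ℓ₁) / 2 + ρ) - (q : ℚ) ^ (2 * ρ + d - 1) else 0) - (if ρ + d ≤ (n₃ - ℓ₁) / 2 + 1 then (q : ℚ) ^ (2 * ρ + d - 2) else 0)))
      = if min (min n₁ n₂) (min (n₂ - ℓ₁) (2 * n₂ - ℓ₂)) / 2 + d ≤ (n₃ - ℓ₁) / 2 then ω * ((q : ℚ) ^ ((n₃ - ℓ₁) / 2 + min (min n₁ n₂) (min (n₂ - ℓ₁) (2 * n₂ - ℓ₂)) / 2 + 1) - (q : ℚ) ^ (2 * (min (min n₁ n₂) (min (n₂ - ℓ₁) (2 * n₂ - ℓ₂)) / 2) + d)) else 0 := by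
    rw [← mul_add, ← mul_add]; exact foot_mul_eval (q : ℚ) ω hd1 _ _
  -- the diagonal window and the three cut windows (★ `window_mul_eval_trunc`, no extra cap: `U := C`)
  have hbrk : ∀ (p : Fin 3) (s c : ℕ), ((i = p → d ≤ s / 2 + c) ∧ (i ≠ p → d ≤ c)) ↔ (if i = p then d - s / 2 else d) ≤ c := by
    intro p s c
    by_cases hip : i = p
    · rw [if_pos hip]; constructor
      · rintro ⟨h, -⟩; have := h hip; omega
      · intro h; exact ⟨fun _ => by omega, fun h' => absurd hip h'⟩
    · rw [if_neg hip]; constructor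
      · rintro ⟨-, h⟩; exact h hip
      · intro h; exact ⟨fun h' => absurd h' hip, fun _ => h⟩
  have eD : ∀ (C A : ℕ), ((q : ℚ) - 1) * (εH * ∑ c ∈ Icc 1 C, (if d ≤ c then (q : ℚ) ^ (A + c) else 0)) =
      εH * (if max 1 d ≤ C then (q : ℚ) ^ (A + C + 1) - (q : ℚ) ^ (A + max 1 d) else 0) := by
    intro C A
    rw [mul_left_comm, ← window_mul_eval_trunc (q : ℚ) A d C C le_rfl (fun c => d ≤ c) (fun _ => Iff.rfl)]
    congr 2
    refine sum_congr rfl fun c hc => ?_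
    rw [mem_Icc] at hc
    simp only [hc.2, and_true]
  have eW : ∀ (p : Fin 3) (s C A : ℕ), ((q : ℚ) - 1) * (εG p i * ∑ c ∈ Icc 1 C, (if (i = p → d ≤ s / 2 + c) ∧ (i ≠ p → d ≤ c) then (q : ℚ) ^ (A + c) else 0)) =
      εG p i * (if max 1 (if i = p then d - s / 2 else d) ≤ C then (q : ℚ) ^ (A + C + 1) - (q : ℚ) ^ (A + max 1 (if i = p then d - s / 2 else d)) else 0) := by
    intro p s C A
    rw [mul_left_comm, ← window_mul_eval_trunc (q : ℚ) A _ C C le_rfl _ (hbrk p s)]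
    congr 2
    refine sum_congr rfl fun c hc => ?_
    rw [mem_Icc] at hc
    simp only [hc.2, and_true]
  simp only [mul_add, mul_ite, mul_zero]
  rw [eD, eF0, eF1, eF2, eW 0 (n₁ - n₂), eW 1 (n₂ - n₁), eW 2 (n₃ - n₁)]
  clear eD eW eF0 eF1 eF2 hbrk
  -- (B) the exponent tiling is `hcore`
  exact hcore q d n₁ n₂ n₃ k ℓ₁ ℓ₂ i ω εH εG hd hiso ⟨hf1, hf2, hf3⟩ hℓ₁ hℓ₂ hcorner h1 h2 h3 hk hω0 hω1 hω2

end Summit.HodgeConjecture.HodgeConjecture.Cruxes.H413.F0P3cDyRamLevBoxSumBlocks
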